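import Summits.QuantumFields.GaugeBoot.Eqs.BindKitZP
import HarnessLib

/-!
# Binding kit, partitioned integer check with the class filter pushed INSIDE the combination (`BindZ.cchkZPf`)

Cell `pub-gaugeboot` (HOME `run/shared/lean/pub/pub-gaugeboot/`), seat lean2 (binding engine; sequel of `Eqs/BindKitZP`).
`cchkZP litZ p q m i c` filters the residue class `i` AFTER forming the whole witness combination, so each of the `m` class checks
still multiplies every term of every referenced literal row.  `cchkZPf` filters each literal row by label-code class FIRST
(`LitZ.cls`), then evaluates and scales only the surviving terms — the same Boolean (`cchkZPf_eq_cchkZP`, proved from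
`cls (lincomb cs) = lincomb (map cls cs)` and `cls (evalZ p q r) = evalZ p q (LitZ.cls r)`), hence the same soundness
(`rowVal_decWZ_eq_zero_of_cchkZPf`), at roughly `1/m` of the big-integer work per class.  Measured motive: one class check of a
kz-L2-rp-4D aggregated row (≈ 10⁴ terms, witness over ≈ 3 100 literal rows) costs ≈ 28 s of kernel time with `cchkZP`.

HONEST FRAMING (page 1 of every file of this cell): certified bounds on lattice expectations at STATED coupling, gauge
group, dimension and torus size; NOT a mass gap, NOT a continuum limit, NOT a string tension, NOT large `N`; NOT
Yang–Mills-summit-bearing (barriers `FixedCouplingUltralocality`, `PerturbativeInvisibility`).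
-/

noncomputable section

open Literature.MathematicalPhysics.QuantumFieldTheory
open Summit.QuantumFields.GaugeBoot.BindN

namespace Summit.QuantumFields.GaugeBoot.BindZ

/-! ## The class filter commutes with the row operations -/

/-- `cls` distributes over concatenation. -/
theorem cls_append (m i : ℕ) (l r : ZRow) : ZRow.cls m i (l ++ r) = ZRow.cls m i l ++ ZRow.cls m i r := by
  simp [ZRow.cls, List.filter_append]

/-- `cls` commutes with scaling (scaling keeps the codes). -/
theorem cls_smul (m i : ℕ) (a : ℤ) (r : ZRow) : ZRow.cls m i (ZRow.smul a r) = ZRow.smul a (ZRow.cls m i r) := by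
  induction r with
  | nil => rfl
  | cons t r ih =>
    by_cases h : t.1 % m = i
    · simp [ZRow.cls, ZRow.smul, h] at ih ⊢
      exact ih
    · simp [ZRow.cls, ZRow.smul, h] at ih ⊢
      exact ih

/-- `cls` of a linear combination is the linear combination of the filtered rows. -/
theorem cls_lincomb (m i : ℕ) (cs : List (ℤ × ZRow)) :
    ZRow.cls m i (ZRow.lincomb cs) = ZRow.lincomb (cs.map fun p => (p.1, ZRow.cls m i p.2)) := by
  induction cs with
  | nil => rfl
  | cons p cs ih =>
    simp only [ZRow.lincomb, List.map_cons, List.flatten_cons] at ih ⊢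
    rw [cls_append, cls_smul, ih]

/-- The class filter on a coded literal row `(code, 4c0, c1)`. -/
def LitZ.cls (m i : ℕ) (r : LitZ) : LitZ := r.filter fun t => t.1 % m = i

/-- `cls` commutes with the integer evaluation at `β = p/q` (evaluation keeps the codes). -/
theorem cls_evalZ (m i : ℕ) (p q : ℤ) (r : LitZ) : ZRow.cls m i (evalZ p q r) = evalZ p q (LitZ.cls m i r) := by
  induction r with
  | nil => rfl
  | cons t r ih =>
    by_cases h : t.1 % m = i
    · simp [ZRow.cls, evalZ, LitZ.cls, h] at ih ⊢
      exact ih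
    · simp [ZRow.cls, evalZ, LitZ.cls, h] at ih ⊢
      exact ih

/-- The witness combination with every literal row filtered to class `i` before evaluation. -/
def comboZf (litZ : ℕ × ℕ → LitZ) (p q : ℤ) (m i : ℕ) (idx : List (ℤ × ℕ × ℕ)) : List (ℤ × ZRow) :=
  idx.map fun e => (e.1, evalZ p q (LitZ.cls m i (litZ e.2)))

/-- Filtering the rows of `comboZ` class-wise gives `comboZf`. -/
theorem map_cls_comboZ (litZ : ℕ × ℕ → LitZ) (p q : ℤ) (m i : ℕ) (idx : List (ℤ × ℕ × ℕ)) :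
    (comboZ litZ p q idx).map (fun pr => (pr.1, ZRow.cls m i pr.2)) = comboZf litZ p q m i idx := by
  simp [comboZ, comboZf, List.map_map, Function.comp_def, cls_evalZ]

/-! ## The filtered check and its equivalence with `cchkZP` -/

/-- **Class `i` (of `m`) of the integer kernel check at `β = p/q`, filter-first form**: `K ≠ 0` and the canonical forms of
the class-`i` part of `K • terms` and of the combination of the class-`i` parts of the evaluated literal rows agree. -/
def cchkZPf (litZ : ℕ × ℕ → LitZ) (p q : ℤ) (m i : ℕ) (c : CRowZ) : Bool :=
  (c.2.2.1 != 0) &&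
    decide (ZRow.mcanon (ZRow.cls m i (ZRow.smul c.2.2.1 c.1)) =
      ZRow.mcanon (ZRow.lincomb (comboZf litZ p q m i c.2.2.2)))

/-- The filter-first check IS the partitioned check. -/
theorem cchkZPf_eq_cchkZP (litZ : ℕ × ℕ → LitZ) (p q : ℤ) (m i : ℕ) (c : CRowZ) :
    cchkZPf litZ p q m i c = cchkZP litZ p q m i c := by
  simp only [cchkZPf, cchkZP, ← map_cls_comboZ, ← cls_lincomb]

variable {d : ℕ} [NeZero d] (W : Word d → ℝ)

/-- **Soundness of the filter-first partitioned check, any valuation** (transported from `rowVal_decWZ_eq_zero_of_cchkZP`). -/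
theorem rowVal_decWZ_eq_zero_of_cchkZPf (litZ : ℕ × ℕ → LitZ) (β₀ : ℚ) (p q : ℤ) (hq : q ≠ 0) (hβ : (p : ℚ) / q = β₀)
    (hlit : ∀ i, rowVal (β₀ : ℝ) W (decRowQ d (litQ (litZ i))) = 0) (m : ℕ) (hm : 0 < m) (c : CRowZ)
    (h : ∀ i < m, cchkZPf litZ p q m i c = true) : rowVal (β₀ : ℝ) W (decWZ d c.1 c.2.1) = 0 :=
  rowVal_decWZ_eq_zero_of_cchkZP W litZ β₀ p q hq hβ hlit m hm c fun i hi => by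
    rw [← cchkZPf_eq_cchkZP]; exact h i hi

/-- Example (closed computation): the `BindKitZP` example, filter-first, both classes. -/
example : cchkZPf (fun _ => [ez 0 4 0, ez 1324 0 (-1)]) 3 2 2 0 ([tz 1324 3, tz 0 (-16)], 7, 4, [lz (-1) 0 0]) = true ∧
    cchkZPf (fun _ => [ez 0 4 0, ez 1324 0 (-1)]) 3 2 2 1 ([tz 1324 3, tz 0 (-16)], 7, 4, [lz (-1) 0 0]) = true := by
  constructor <;> decide +kernel

end Summit.QuantumFields.GaugeBoot.BindZ

end
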